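import Summits.BirchSwinnertonDyer.BirchSwinnertonDyer.Theorems.ResidualThetaTransportAtTwoThetaLayerLambdaCongruenceAtTwoLayerLambdaStable
import Summits.BirchSwinnertonDyer.BirchSwinnertonDyer.Theorems.ResidualThetaTransportAtTwoThetaLayerLambdaCongruenceAtTwoLayerAlgebra
import Summits.BirchSwinnertonDyer.BirchSwinnertonDyer.Theorems.ResidualThetaTransportAtTwoResidualThetaMainConjectureAtTwoLayerToolkit
import Literature.NumberTheory.IwasawaTheory.LayerIwasawaInvariants
import HarnessLib

/-!
# Crux `ResidualThetaMainConjectureAtTwo` (stmt-BirchSwinnertonDyer-20787), line `birth` v4 — the Mazur–Tate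
# layer law from a Pollack congruence IN NORM LANGUAGE (coefficient ring `𝓞` of any ultrametric field)

Cell `bsd-wall`, seat `bsd-wall-rtt-p2` (LEAD PROVER, line mode, g2). THEOREMS ONLY (no `def`, no named fact, no
`sorry`); `--supports stmt-BirchSwinnertonDyer-20787`; closes nothing by itself. This is the engine of stub (R1b)
`stub_analyticLayerLawKAtTwo` (the g-side analytic layer law over `𝓞 = 𝓞_{ℚ₂(ι K_g)}`): the `ℤ_p`-integral-model
lemma of the sibling file `…MazurTateLayer` (`exists_integralModel_of_isCongrModOmega`: `θ ≡ ω·L (mod ω_n)`,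
`ω ≡ u X^d (mod p)` ⟹ `θ = p^μ P`, `ord_X P̄ = d + λ(L)`) re-proved WITHOUT reduction maps, uniformisers or the
`μ/λ` of `Λ = ℤ_p⟦T⟧`, purely with coefficient norms over an ultrametric normed field `K` — so that it applies verbatim
to `L ∈ 𝓞⟦T⟧ ⊂ ℚ̄_p⟦T⟧` for the ring of integers `𝓞` of ANY closed subfield of `ℚ̄_p` (no discrete valuation needed):

* `supNorm_eq_and_layerLambda_eq_of_layerCongruence` — let `c ≠ 0`, `θ ∈ K[X]` with `θ_j = 0` for `j ≥ N`,
  `ω, ω⁻ ∈ K[X]` with `ω_N = 1`, `‖ω_j‖ ≤ r` (`j ≠ N`), `‖ω⁻_D‖ = 1`, `‖ω⁻_j‖ ≤ r` (`j ≠ D`) for some `r < 1`,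
  `L, q ∈ K⟦X⟧` with `q` coefficientwise bounded and `L` of Gauss norm `s > 0` FIRST attained at the index `d`
  (`‖L_k‖ ≤ s`, `‖L_d‖ = s`, `‖L_k‖ < s` for `k < d`). If `c·(θ − ω⁻·L) = ω·q` and `D + d < N` then
  `‖θ‖_sup = s` and `layerLambda θ = D + d`.
  PROOF. (Claim A) `t = sup_k ‖q_k‖ ≤ ‖c‖·s`: comparing coefficients in degree `N + k` (where `θ` vanishes),
  `q_k = −c(ω⁻L)_{N+k} − Σ_{i≠N} ω_i q_{N+k−i}`, so `‖q_k‖ ≤ max(‖c‖s, r·t)`, whence `t ≤ max(‖c‖s, r t)` and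
  `t ≤ ‖c‖s` because `r < 1`. (Main estimate) for `j < N`: `c θ_j = c(ω⁻L)_j + (ωq)_j`, `(ωq)_j` only involves
  `ω_i` with `i ≤ j < N` (norm `≤ r‖c‖s`), and `(ω⁻L)_j = ω⁻_D L_{j−D} + Σ_{i≠D}` (error `≤ r s`); hence
  `‖θ_j − ω⁻_D·L_{j−D}·[D ≤ j]‖ ≤ r·s < s`, and the three readings (`< s` below `D + d`, `= s` at `D + d`,
  `≤ s` everywhere) follow from the ultrametric isosceles principle.
This is Pollack 2003 Prop. 6.18 with Prop. 6.9 / Pollack–Weston 2011 §4 ("`λ(θ_n) = q_n + λ^∓`, `μ(θ_n) = μ^∓` for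
`n ≫ 0`") for coefficients in `𝓞`, valid at every prime. BSD is not proved by any of this.

References: R. Pollack, Duke Math. J. 118 (2003) Prop. 6.9, Prop. 6.18 [Pollack2003]; R. Pollack, T. Weston,
Duke Math. J. 156 (2011) §3.1, §4 [PollackWeston2011MT]; L. Washington, *Cyclotomic fields*, §7.1 [Washington1997].
-/

set_option linter.dupNamespace false
set_option autoImplicit false

noncomputable section

open scoped Classical

open Polynomial Literature.NumberTheory.IwasawaTheory
  Summit.BirchSwinnertonDyer.BirchSwinnertonDyer.Theorems.ThetaLayerLambdaCongruenceAtTwo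

namespace Summit.BirchSwinnertonDyer.BirchSwinnertonDyer.Theorems.ResidualThetaLayer

section NormLanguage

variable {K : Type*} [NormedField K] [IsUltrametricDist K]

omit [IsUltrametricDist K] in
/-- Coefficient `n` of `(ω : K⟦X⟧) · q` split at the term `ω_N · q_k` when `n = N + k`: the remaining terms only
involve coefficients `ω_i` with `i ≠ N`. [folklore] -/
theorem coeff_coe_mul_eq_add_sum_erase (ω : K[X]) (q : PowerSeries K) (N k : ℕ) :
    PowerSeries.coeff (N + k) ((ω : PowerSeries K) * q) =
      ω.coeff N * PowerSeries.coeff k q +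
        ∑ x ∈ (Finset.antidiagonal (N + k)).erase (N, k),
          ω.coeff x.1 * PowerSeries.coeff x.2 q := by
  rw [PowerSeries.coeff_mul]
  have hmem : (N, k) ∈ Finset.antidiagonal (N + k) := by simp
  rw [← Finset.add_sum_erase _ _ hmem]
  simp only [Polynomial.coeff_coe]

/-- In the split above, every remaining index pair `x` has `x.1 ≠ N`. [folklore] -/
theorem fst_ne_of_mem_erase_antidiagonal {N k : ℕ} {x : ℕ × ℕ}
    (hx : x ∈ (Finset.antidiagonal (N + k)).erase (N, k)) : x.1 ≠ N := by
  rw [Finset.mem_erase, Finset.mem_antidiagonal] at hx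
  obtain ⟨hne, hsum⟩ := hx
  intro h
  apply hne
  have h2 : x.2 = k := by omega
  exact Prod.ext h h2

/-- Ultrametric bound for a coefficient of a product of a polynomial and a power series: if `‖ω_i‖ ≤ a` for all
`i` and `‖q_l‖ ≤ b` for all `l` (`a, b ≥ 0`) then `‖(ω q)_n‖ ≤ a·b`. [folklore] -/
theorem norm_coeff_coe_mul_le (ω : K[X]) (q : PowerSeries K) {a b : ℝ} (ha : 0 ≤ a) (hb : 0 ≤ b)
    (hω : ∀ i, ‖ω.coeff i‖ ≤ a) (hq : ∀ l, ‖PowerSeries.coeff l q‖ ≤ b) (n : ℕ) :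
    ‖PowerSeries.coeff n ((ω : PowerSeries K) * q)‖ ≤ a * b := by
  rw [PowerSeries.coeff_mul]
  refine norm_sum_le_of_forall_le' (mul_nonneg ha hb) fun x _ ↦ ?_
  rw [Polynomial.coeff_coe, norm_mul]
  exact mul_le_mul (hω x.1) (hq x.2) (norm_nonneg _) ha

/-- **The Mazur–Tate layer law from a Pollack congruence, in norm language.** See the module docstring:
from `c·(θ − ω⁻·L) = ω·q` with `ω ≡ X^N`, `ω⁻ ≡ (unit)·X^D` up to coefficients of norm `≤ r < 1`, `q` bounded,
`deg θ < N`, and `L` of Gauss norm `s > 0` first attained at `d`, if `D + d < N` then `‖θ‖_sup = s` and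
`layerLambda θ = D + d`. [cite: Pollack2003, Prop. 6.18 and Prop. 6.9] [cite: PollackWeston2011MT, §3.1 and §4] -/
theorem supNorm_eq_and_layerLambda_eq_of_layerCongruence {N D d : ℕ} {r s : ℝ} (hr : r < 1) (hs : 0 < s)
    {θ ω ωm : K[X]} {L q : PowerSeries K} {c : K} (hc : c ≠ 0)
    (hθ : ∀ j, N ≤ j → θ.coeff j = 0)
    (hωN : ω.coeff N = 1) (hω : ∀ j, j ≠ N → ‖ω.coeff j‖ ≤ r)
    (hωmD : ‖ωm.coeff D‖ = 1) (hωm : ∀ j, j ≠ D → ‖ωm.coeff j‖ ≤ r)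
    (hL : ∀ k, ‖PowerSeries.coeff k L‖ ≤ s) (hLd : ‖PowerSeries.coeff d L‖ = s)
    (hLlt : ∀ k, k < d → ‖PowerSeries.coeff k L‖ < s)
    (hq : ∃ B : ℝ, ∀ k, ‖PowerSeries.coeff k q‖ ≤ B)
    (hcong : PowerSeries.C c * ((θ : PowerSeries K) - (ωm : PowerSeries K) * L) = (ω : PowerSeries K) * q)
    (hroom : D + d < N) :
    θ.supNorm = s ∧ layerLambda θ = D + d := by
  -- basic positivity
  have hc0 : 0 < ‖c‖ := norm_pos_iff.mpr hc
  have hcs : 0 < ‖c‖ * s := mul_pos hc0 hs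
  have hr0 : 0 ≤ r := by
    have hN : N ≠ D + d + 1 ∨ N = D + d + 1 := by omega
    -- `r` bounds the norm of some coefficient: use `ω` at an index `≠ N`
    by_cases h : N = 0
    · exact (norm_nonneg _).trans (hω 1 (by omega))
    · exact (norm_nonneg _).trans (hω 0 (by omega))
  have hω1 : ∀ i, ‖ω.coeff i‖ ≤ 1 := fun i ↦ by
    by_cases hi : i = N
    · rw [hi, hωN, norm_one]
    · exact (hω i hi).trans hr.le
  have hωm1 : ∀ i, ‖ωm.coeff i‖ ≤ 1 := fun i ↦ by
    by_cases hi : i = D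
    · rw [hi, hωmD]
    · exact (hωm i hi).trans hr.le
  -- coefficientwise form of the congruence: `c θ_j = c (ωm L)_j + (ω q)_j`
  have hE : ∀ j, c * θ.coeff j =
      c * PowerSeries.coeff j ((ωm : PowerSeries K) * L) + PowerSeries.coeff j ((ω : PowerSeries K) * q) := by
    intro j
    have h := congrArg (PowerSeries.coeff j) hcong
    rw [PowerSeries.coeff_C_mul, map_sub, Polynomial.coeff_coe, mul_sub] at h
    rw [← h]
    ring
  -- ### Claim A: `‖q_k‖ ≤ ‖c‖ s` for all `k`
  obtain ⟨B, hB⟩ := hq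
  have hbdd : BddAbove (Set.range fun k ↦ ‖PowerSeries.coeff k q‖) := ⟨B, by rintro _ ⟨k, rfl⟩; exact hB k⟩
  set t : ℝ := ⨆ k, ‖PowerSeries.coeff k q‖ with ht
  have hqt : ∀ k, ‖PowerSeries.coeff k q‖ ≤ t := fun k ↦ le_ciSup hbdd k
  have ht0 : 0 ≤ t := (norm_nonneg _).trans (hqt 0)
  -- `‖(ωm L)_n‖ ≤ s`
  have hωmL : ∀ n, ‖PowerSeries.coeff n ((ωm : PowerSeries K) * L)‖ ≤ s := fun n ↦ by
    have := norm_coeff_coe_mul_le ωm L zero_le_one hs.le hωm1 hL n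
    rwa [one_mul] at this
  have hqk : ∀ k, ‖PowerSeries.coeff k q‖ ≤ max (‖c‖ * s) (r * t) := by
    intro k
    have h1 := hE (N + k)
    rw [hθ (N + k) (Nat.le_add_right N k), mul_zero, coeff_coe_mul_eq_add_sum_erase ω q N k, hωN, one_mul] at h1
    -- `q_k = -(c (ωm L)_{N+k}) - Σ_{i ≠ N} ω_i q_l`
    have h2 : PowerSeries.coeff k q =
        -(c * PowerSeries.coeff (N + k) ((ωm : PowerSeries K) * L)) -
          ∑ x ∈ (Finset.antidiagonal (N + k)).erase (N, k), ω.coeff x.1 * PowerSeries.coeff x.2 q := by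
      linear_combination (-1 : K) * h1
    rw [h2, sub_eq_add_neg]
    refine (IsUltrametricDist.norm_add_le_max _ _).trans (max_le_max ?_ ?_)
    · rw [norm_neg, norm_mul]
      exact mul_le_mul_of_nonneg_left (hωmL _) hc0.le
    · rw [norm_neg]
      refine norm_sum_le_of_forall_le' (mul_nonneg hr0 ht0) fun x hx ↦ ?_
      rw [norm_mul]
      exact mul_le_mul (hω x.1 (fst_ne_of_mem_erase_antidiagonal hx)) (hqt x.2) (norm_nonneg _) hr0
  have htle : t ≤ max (‖c‖ * s) (r * t) := ciSup_le hqk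
  have hA : t ≤ ‖c‖ * s := by
    by_contra h
    push Not at h
    have h1 : t ≤ r * t := by
      rcases le_max_iff.mp htle with h' | h'
      · exact absurd h' (not_le.mpr h)
      · exact h'
    have h2 : 0 < t := hcs.trans h
    have h3 : r * t < 1 * t := mul_lt_mul_of_pos_right hr h2
    rw [one_mul] at h3
    exact absurd h1 (not_le.mpr h3)
  have hqA : ∀ k, ‖PowerSeries.coeff k q‖ ≤ ‖c‖ * s := fun k ↦ (hqt k).trans hA
  -- ### Main estimate: for `j < N`, `‖θ_j − ωm_D · L_{j-D} · [D ≤ j]‖ ≤ r s`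
  have hmain : ∀ j, j < N →
      ‖θ.coeff j - (if D ≤ j then ωm.coeff D * PowerSeries.coeff (j - D) L else 0)‖ ≤ r * s := by
    intro j hj
    -- `(ω q)_j` has norm `≤ r ‖c‖ s` (only `ω_i`, `i ≤ j < N`, occur)
    have hωq : ‖PowerSeries.coeff j ((ω : PowerSeries K) * q)‖ ≤ r * (‖c‖ * s) := by
      rw [PowerSeries.coeff_mul]
      refine norm_sum_le_of_forall_le' (mul_nonneg hr0 hcs.le) fun x hx ↦ ?_
      rw [Finset.mem_antidiagonal] at hx
      rw [Polynomial.coeff_coe, norm_mul]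
      exact mul_le_mul (hω x.1 (by omega)) (hqA x.2) (norm_nonneg _) hr0
    -- `(ωm L)_j = main + Σ_{i ≠ D}` with the error of norm `≤ r s`
    have hωmLj : ‖PowerSeries.coeff j ((ωm : PowerSeries K) * L) -
        (if D ≤ j then ωm.coeff D * PowerSeries.coeff (j - D) L else 0)‖ ≤ r * s := by
      by_cases hDj : D ≤ j
      · rw [if_pos hDj]
        obtain ⟨k, rfl⟩ := Nat.exists_eq_add_of_le hDj
        rw [coeff_coe_mul_eq_add_sum_erase ωm L D k, Nat.add_sub_cancel_left, add_sub_cancel_left]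
        refine norm_sum_le_of_forall_le' (mul_nonneg hr0 hs.le) fun x hx ↦ ?_
        rw [norm_mul]
        exact mul_le_mul (hωm x.1 (fst_ne_of_mem_erase_antidiagonal hx)) (hL x.2) (norm_nonneg _) hr0
      · rw [if_neg hDj, sub_zero, PowerSeries.coeff_mul]
        refine norm_sum_le_of_forall_le' (mul_nonneg hr0 hs.le) fun x hx ↦ ?_
        rw [Finset.mem_antidiagonal] at hx
        rw [Polynomial.coeff_coe, norm_mul]
        exact mul_le_mul (hωm x.1 (by omega)) (hL x.2) (norm_nonneg _) hr0
    -- combine: `c (θ_j − main) = c((ωm L)_j − main) + (ω q)_j`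
    set mn : K := (if D ≤ j then ωm.coeff D * PowerSeries.coeff (j - D) L else 0) with hmn
    have hcomb : c * (θ.coeff j - mn) =
        c * (PowerSeries.coeff j ((ωm : PowerSeries K) * L) - mn) +
          PowerSeries.coeff j ((ω : PowerSeries K) * q) := by
      rw [mul_sub, hE j]; ring
    have hnorm : ‖c‖ * ‖θ.coeff j - mn‖ ≤ ‖c‖ * (r * s) := by
      rw [← norm_mul, hcomb]
      refine (IsUltrametricDist.norm_add_le_max _ _).trans (max_le ?_ ?_)
      · rw [norm_mul]
        exact mul_le_mul_of_nonneg_left hωmLj hc0.le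
      · calc ‖PowerSeries.coeff j ((ω : PowerSeries K) * q)‖ ≤ r * (‖c‖ * s) := hωq
          _ = ‖c‖ * (r * s) := by ring
    exact le_of_mul_le_mul_left hnorm hc0
  have hrs : r * s < s := by
    calc r * s < 1 * s := mul_lt_mul_of_pos_right hr hs
      _ = s := one_mul s
  -- ### The three readings
  have hle : ∀ j, ‖θ.coeff j‖ ≤ s := by
    intro j
    by_cases hj : j < N
    · have h1 := hmain j hj
      have hm : ‖(if D ≤ j then ωm.coeff D * PowerSeries.coeff (j - D) L else 0)‖ ≤ s := by
        split_ifs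
        · rw [norm_mul, hωmD, one_mul]; exact hL _
        · rw [norm_zero]; exact hs.le
      have h2 : ‖θ.coeff j‖ ≤ max ‖θ.coeff j - (if D ≤ j then ωm.coeff D * PowerSeries.coeff (j - D) L else 0)‖
          ‖(if D ≤ j then ωm.coeff D * PowerSeries.coeff (j - D) L else 0)‖ := by
        simpa using IsUltrametricDist.norm_add_le_max
          (θ.coeff j - (if D ≤ j then ωm.coeff D * PowerSeries.coeff (j - D) L else 0))
          (if D ≤ j then ωm.coeff D * PowerSeries.coeff (j - D) L else 0)
      exact h2.trans (max_le (h1.trans hrs.le) hm)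
    · rw [hθ j (not_lt.mp hj), norm_zero]; exact hs.le
  have heq : ‖θ.coeff (D + d)‖ = s := by
    have h1 := hmain (D + d) hroom
    rw [if_pos (Nat.le_add_right D d), Nat.add_sub_cancel_left] at h1
    have hm : ‖ωm.coeff D * PowerSeries.coeff d L‖ = s := by rw [norm_mul, hωmD, one_mul, hLd]
    have h2 : ‖ωm.coeff D * PowerSeries.coeff d L - θ.coeff (D + d)‖ < s := by
      rw [norm_sub_rev]; exact h1.trans_lt hrs
    exact norm_eq_of_norm_sub_lt_of_norm_eq h2 hm
  have hlt : ∀ j, j < D + d → ‖θ.coeff j‖ < s := by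
    intro j hj
    have h1 := hmain j (hj.trans hroom)
    have hm : ‖(if D ≤ j then ωm.coeff D * PowerSeries.coeff (j - D) L else 0)‖ < s := by
      split_ifs with hDj
      · rw [norm_mul, hωmD, one_mul]; exact hLlt _ (by omega)
      · rw [norm_zero]; exact hs
    have h2 : ‖(if D ≤ j then ωm.coeff D * PowerSeries.coeff (j - D) L else 0) - θ.coeff j‖ < s := by
      rw [norm_sub_rev]; exact h1.trans_lt hrs
    exact norm_lt_of_norm_sub_lt_of_norm_lt h2 hm
  have hsup : θ.supNorm = s := supNorm_eq_of_forall_le θ hle heq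
  refine ⟨hsup, ?_⟩
  rw [layerLambda_eq_iff, hsup]
  exact ⟨heq, fun j hj ↦ hlt j hj⟩

end NormLanguage

end Summit.BirchSwinnertonDyer.BirchSwinnertonDyer.Theorems.ResidualThetaLayer

end
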